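import Literature.MathematicalPhysics.QuantumFieldTheory.Balaban1983to89.B9CoReadingCoordsS
import Literature.MathematicalPhysics.QuantumFieldTheory.Balaban1983to89.B9Ineq349SiteFromBlocks
import Literature.MathematicalPhysics.QuantumFieldTheory.Balaban1983to89.B9RWSumsReadsNbr

/-!
# `Balaban1983to89.B9CoordSliceMajorant` — T. Bałaban, *Propagators for lattice gauge theories in a background field*, Commun. Math. Phys. **99** (1985)
# 389–434 [Balaban1985BackgroundPropagators], Thm 3.1 (3.42) p. 397 read through [4] (2.51)–(2.52) p. 232: A GENERAL `𝔤`-VALUED TEST FUNCTION IS ONE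
# SLICE OF THE κ-FOLD COORDINATE MODEL — a block majorant of the model (n06-d `B9CoReadingCoordsS`, the N06 knit's site pins) bounds the reading at
# EVERY `λ` supported in a block, not only at product-form `J ⊗ E`; and the block sums this produces under a LEVEL-∕1-FAITHFUL block map

[4] = T. Bałaban, *Propagators and renormalization transformations for lattice gauge theories. II*, Commun. Math. Phys. **96** (1984) 223–250
[`Balaban1984PropagatorsII`].

statement-level skeleton of published theorems with citation tags; proofs where landed; nothing here is a claim about the Yang–Mills mass gap

THE PRINT.  p. 397 (3.42): *«|(G′(U)λ)(x)|, |(∇_U G′(U)λ)(x)|, … ≦ B₀[(Lʲη)², Lʲη, …]e^{−δ₀d(y,y′)}|λ| for x ∈ Δ(y), y ∈ Λ_j, supp λ ⊂ Δ(y′)»* — for EVERY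
`𝔤`-valued `λ` supported in a block; p. 410: *«Theorem 3.7 implies that all the inequalities (3.42)–(3.47) hold for G′»*; [4] p. 232 (2.51)–(2.52): the
block majorants `|(Tλ)(x)| ≤ K(y, y′)|λ|` and the decomposition `λ = Σ_{y″} Δ(y″)λ`.

WHY THIS FILE (dag-n06-i gen 11, N06 bundle F4, row 25).  The N06 knit proves Theorem 3.7 for the genuine `G′(U)` as block majorants of n06-d's κ-fold
REAL COORDINATE MODELS `GcoS`, `DcoS ∘ GcoS` (`B9Thm37Whole.Conv342` at the site pins), but so far READS them only at product-form test functions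
`J ⊗ E` (`B9CoReadingCoordsS.norm_le_of_coordModelK_le_at`, def-Y's `kernelFamilyS`).  Row 25's (3.49) needs (3.42) at the NON-product test functions
`λ = Q′*_U(δ_{y₁} ⊗ F)` (`B9Ineq349SiteComposite.Left342At`).  The model is slice-wise conjugation by the coordinates of the basis `b`
(`coordOpK_apply`), so ONE `(ν₀, c₀)`-slice carries any `λ : S → 𝔸` (`sliceK`, `assembleK_sliceK`) — the majorant reaches every `λ`.

WHAT IS PROVED (sorry-free; finite-dimensional linear algebra and lattice bookkeeping; no estimate of the paper).
* §1 `sliceK`, `assembleK_sliceK`, `coordOpK_sliceK`, `abs_sliceK_le`, `sliceK_eq_zero_of`; ★ `norm_le_of_cR39_repr_le` (`cR39·|repr_c w| ≤ coordBound·A`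
  for all `c` ⇒ `‖w‖ ≤ A`, the factors `basisBound·|κ|` of `cR39` paying for the re-assembly; degenerate bases give `w = 0`);
  ★★ `mul_norm_apply_le_of_hasMajorantHom`: a two-space majorant `K ≥ 0` of `(r·cR39 b) • coordOpK b T` for the block map `p ↦ sI p.1` gives, for every
  `λ` vanishing off a point set `P`, `‖λ‖ ≤ cλ`, and every finite block set `I ⊇ sI(P)`: `r·‖(T ν λ)(x)‖ ≤ cλ · Σ_{b₁ ∈ I} K(sI x, b₁)` — constant-free.
* §2 at a member `x` of def-Y's record geometry `geo9Y x`, for a block map `bI` on fine bonds LEVEL-FAITHFUL (`hlev`) and 1-FAITHFUL (`hβ1`) — two of the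
  three geometric binders of the knit's coordinate pins (n06-k `B9IndexBondFaithful`) — and the site map `sIK bI`: `len_sIK_eq_lenB` (the model length IS
  print's `Lʲη` of the block of the site), `distB_sIK_le_one`, `distB_comm`, ★ `distB_le_dist_sIK_add_two` (`d_T(Δ(z), Δ(z₁)) ≤ d(sI z, sI z₁) + 2`, (2.54)
  twice), `exp_dist_sIK_le`, ★ `card_image_sIK_le` (the index bonds met by one block lie in one radius-2 neighbourhood: `≤ mN` under the knit's count
  `#nbr(·,2) ≤ mN`, n06-i `B9GeoNbrCountKLevelV1`), ★★ `sum_image_sIK_le` (the block sum of `C·w(Lʲη)·e^{−δd}` over the blocks met by `B(y₁)` is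
  `≤ mN·C·w(lenB y)·e^{2δ}·e^{−δ d_T(y,y₁)}`).
The consumer is the sibling `B9Ineq349SiteFromConv342` (`Left342At`, hence row 25, from the knit's Theorem-3.7 majorants).

HONEST SCOPE.  Bookkeeping over landed objects (n06-d's coordinate model, n06-k's faithful block map and neighbourhood count, n06-i's (3.49) schemas);
nothing of [B9] or [4] is asserted; count-neutral; N06 NOT discharged; one finite 𝕋^{d+1} programme at fixed ε — nothing continuum, nothing OS,
nothing about the mass gap.  Cell `pub-ymgap` (HUMAN RULING D-0062), Track A node N06 [B9], seat `pub-ymgap-dag-n06-i` (gen 11), 2026-08-27; a NEW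
file, nothing landed is modified.
-/

noncomputable section

namespace Literature.MathematicalPhysics.QuantumFieldTheory.Balaban1983to89.B9CoordSliceMajorant

open B6RandomWalk (HasMajorant BlockSupp blockPiece sum_blockPiece blockSupp_blockPiece)
open B6RandomWalkHom (HasMajorantHom hasMajorantHom_iff)
open B9CoReadingCoords (assembleK coordOpK coordOpK_apply)
open B9Thm39ReadingCoords (cR39 cR39_nonneg coordBound39 basisBound39 abs_repr_le norm_sum_smul_basis_le)

variable {𝔸 : Type} [NormedRing 𝔸] [NormedAlgebra ℂ 𝔸]
variable {κ : Type} [Fintype κ] [DecidableEq κ]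

/-! ## §1 A GENERAL `𝔸`-valued test function in ONE slice of the κ-fold coordinates; the reading dominated through a block majorant -/

section Slice

variable {S D : Type} [DecidableEq D] (b : Module.Basis κ ℝ 𝔸)

/-- **the slice embedding**: the coordinates of a general `𝔸`-valued `λ : S → 𝔸` placed in the `(ν₀, ·, c₀)`-slice of the κ-fold carrier
`S × D × κ × κ` (zero in every other slice) — `assembleK b ν₀ c₀` recovers `λ`. [cite: Balaban1985BackgroundPropagators, (3.42) p.397 («λ», any 𝔤-valued test function), dictionary] -/
def sliceK (ν₀ : D) (c₀ : κ) (lam : S → 𝔸) : S × D × κ × κ → ℝ :=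
  fun p => if p.2.1 = ν₀ ∧ p.2.2.2 = c₀ then b.repr (lam p.1) p.2.2.1 else 0

omit [Fintype κ] in
/-- the slice embedding, evaluated in its own slice. [cite: Balaban1985BackgroundPropagators, (3.42) p.397, bookkeeping] -/
theorem sliceK_apply_same (ν₀ : D) (c₀ : κ) (lam : S → 𝔸) (z : S) (a : κ) : sliceK b ν₀ c₀ lam (z, ν₀, a, c₀) = b.repr (lam z) a := by
  simp [sliceK]

/-- ★ the slice re-assembles to `λ`. [cite: Balaban1985BackgroundPropagators, (3.42) p.397, dictionary] -/
theorem assembleK_sliceK (ν₀ : D) (c₀ : κ) (lam : S → 𝔸) : assembleK b ν₀ c₀ (sliceK b ν₀ c₀ lam) = lam := by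
  funext z
  simp only [assembleK, sliceK_apply_same]
  exact b.sum_repr (lam z)

/-- ★ the coordinate model on the slice reads the coordinates of `T ν₀ λ`. [cite: Balaban1985BackgroundPropagators, (3.42) p.397, dictionary] -/
theorem coordOpK_sliceK (T : D → (S → 𝔸) →ₗ[ℝ] (S → 𝔸)) (ν₀ : D) (c₀ : κ) (lam : S → 𝔸) (x : S) (c : κ) :
    coordOpK b T (sliceK b ν₀ c₀ lam) (x, ν₀, c, c₀) = b.repr (T ν₀ lam x) c := by
  rw [coordOpK_apply]
  simp only [assembleK_sliceK]

/-- `|sliceK λ p| ≤ coordBound · ‖λ(p.1)‖`. [cite: Balaban1985BackgroundPropagators, (3.42) p.397 («|λ|»), bookkeeping] -/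
theorem abs_sliceK_le [FiniteDimensional ℝ 𝔸] (ν₀ : D) (c₀ : κ) (lam : S → 𝔸) (p : S × D × κ × κ) :
    |sliceK b ν₀ c₀ lam p| ≤ coordBound39 b * ‖lam p.1‖ := by
  unfold sliceK
  split_ifs
  · exact abs_repr_le b _ _
  · rw [abs_zero]; exact mul_nonneg (norm_nonneg _) (norm_nonneg _)

omit [Fintype κ] in
/-- the slice vanishes wherever `λ` does. [cite: Balaban1985BackgroundPropagators, (3.42) p.397 («supp λ ⊂ Δ(y′)»), bookkeeping] -/
theorem sliceK_eq_zero_of (ν₀ : D) (c₀ : κ) {lam : S → 𝔸} {p : S × D × κ × κ} (h : lam p.1 = 0) : sliceK b ν₀ c₀ lam p = 0 := by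
  unfold sliceK
  split_ifs
  · rw [h, map_zero]; rfl
  · rfl

omit [DecidableEq κ] in
/-- ★ **from scaled coordinate bounds to the norm, constant-free**: if `cR39 b · |repr_c w| ≤ coordBound39 b · A` for every output coordinate `c`
(`A ≥ 0`), then `‖w‖ ≤ A` — the factors `basisBound · |κ|` inside `cR39` pay for re-assembling `w = Σ_c repr_c w • b_c` (degenerate bases:
`w = 0`). [cite: Balaban1985BackgroundPropagators, (3.39) p.397 (the norm read), dictionary] -/
theorem norm_le_of_cR39_repr_le [FiniteDimensional ℝ 𝔸] (w : 𝔸) {A : ℝ} (hA : 0 ≤ A)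
    (h : ∀ c, cR39 b * |b.repr w c| ≤ coordBound39 b * A) : ‖w‖ ≤ A := by
  have hw : w = ∑ c, b.repr w c • b c := (b.sum_repr w).symm
  have hbB0 : 0 ≤ basisBound39 b := Finset.sum_nonneg fun _ _ => norm_nonneg _
  have hcB0 : 0 ≤ coordBound39 b := norm_nonneg _
  rcases isEmpty_or_nonempty κ with hκ | hκ
  · have : w = 0 := by rw [hw]; exact Finset.sum_eq_zero fun c _ => (hκ.false c).elim
    rw [this, norm_zero]; exact hA
  by_cases hbB : basisBound39 b = 0
  · have hb : ∀ c, b c = 0 := by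
      intro c
      have h0 : ‖b c‖ = 0 := by
        have := (Finset.sum_eq_zero_iff_of_nonneg (fun c _ => norm_nonneg (b c))).1 hbB c (Finset.mem_univ c)
        exact this
      exact norm_eq_zero.1 h0
    have : w = 0 := by rw [hw]; exact Finset.sum_eq_zero fun c _ => by rw [hb c, smul_zero]
    rw [this, norm_zero]; exact hA
  by_cases hcB : coordBound39 b = 0
  · have hr : ∀ c, b.repr w c = 0 := by
      intro c
      have := abs_repr_le b w c
      rw [hcB, zero_mul] at this
      exact abs_eq_zero.1 (le_antisymm this (abs_nonneg _))
    have : w = 0 := by rw [hw]; exact Finset.sum_eq_zero fun c _ => by rw [hr c, zero_smul]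
    rw [this, norm_zero]; exact hA
  have hbBp : 0 < basisBound39 b := lt_of_le_of_ne hbB0 (Ne.symm hbB)
  have hcBp : 0 < coordBound39 b := lt_of_le_of_ne hcB0 (Ne.symm hcB)
  have hk : (1 : ℝ) ≤ Fintype.card κ := by exact_mod_cast Fintype.card_pos (α := κ)
  have hkp : (0 : ℝ) < Fintype.card κ := lt_of_lt_of_le one_pos hk
  -- each coordinate: `|repr_c w| ≤ A ∕ (basisBound · |κ|)`
  have hcoord : ∀ c, |b.repr w c| ≤ A / (basisBound39 b * Fintype.card κ) := by
    intro c
    rw [le_div_iff₀ (mul_pos hbBp hkp)]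
    have h1 := h c
    rw [cR39] at h1
    -- h1 : coordBound * basisBound * |κ| * |repr| ≤ coordBound * A
    have h2 : coordBound39 b * (|b.repr w c| * (basisBound39 b * Fintype.card κ)) ≤ coordBound39 b * A := by
      calc coordBound39 b * (|b.repr w c| * (basisBound39 b * Fintype.card κ))
          = coordBound39 b * basisBound39 b * Fintype.card κ * |b.repr w c| := by ring
        _ ≤ coordBound39 b * A := h1
    exact le_of_mul_le_mul_left h2 hcBp
  calc ‖w‖ = ‖∑ c, b.repr w c • b c‖ := by rw [← hw]
    _ ≤ basisBound39 b * ∑ c, |b.repr w c| := norm_sum_smul_basis_le b _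
    _ ≤ basisBound39 b * ∑ _c : κ, A / (basisBound39 b * Fintype.card κ) :=
        mul_le_mul_of_nonneg_left (Finset.sum_le_sum fun c _ => hcoord c) hbB0
    _ = A := by
        rw [Finset.sum_const, Finset.card_univ, nsmul_eq_mul]
        field_simp

variable {g : B6.Geometry}

/-- ★★ **THE READING OF A GENERAL TEST FUNCTION DOMINATED THROUGH A BLOCK MAJORANT OF THE COORDINATE MODEL** ([4] (2.51) shape, print's (3.42)
«|(Tλ)(x)| ≤ K(y, y′)|λ|, supp λ ⊂ Δ(y′)»): if the `(r·cR39)`-scaled coordinate model of the family `T` has the two-space majorant `K ≥ 0` for the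
block map `p ↦ sI p.1`, then for every `λ` vanishing outside the point set `P` and bounded by `cl` there, and every `x, ν`:
`r·‖(T ν λ)(x)‖ ≤ cl · Σ_{b₁ ∈ I} K(sI x, b₁)` for any finite set of blocks `I ⊇ sI(P)` — the test function is carried by ONE slice of the model
(not product-form), its block decomposition `λ = Σ_{b₁} Δ(b₁)λ` runs over the blocks met by its support.
[cite: Balaban1985BackgroundPropagators, Thm 3.1 (3.42) p.397; Balaban1984PropagatorsII, (2.51)–(2.52) p.232] -/
theorem mul_norm_apply_le_of_hasMajorantHom [FiniteDimensional ℝ 𝔸] (sI : S → g.Site)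
    {T : D → (S → 𝔸) →ₗ[ℝ] (S → 𝔸)} {r : ℝ} (hr : 0 ≤ r) {K : g.Site → g.Site → ℝ} (hK : ∀ a a', 0 ≤ K a a')
    (hT : HasMajorantHom (g := g) (fun p : S × D × κ × κ => sI p.1) (fun p : S × D × κ × κ => sI p.1) ((r * cR39 b) • coordOpK b T) K)
    (P : S → Prop) {lam : S → 𝔸} (hsupp : ∀ z, ¬ P z → lam z = 0) {cl : ℝ} (hc : 0 ≤ cl)
    (hbd : ∀ z, ‖lam z‖ ≤ cl) (I : Finset g.Site) (hI : ∀ z, P z → sI z ∈ I) (x : S) (ν : D) :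
    r * ‖T ν lam x‖ ≤ cl * ∑ b₁ ∈ I, K (sI x) b₁ := by
  classical
  set SK : ℝ := ∑ b₁ ∈ I, K (sI x) b₁ with hSK
  have hSK0 : 0 ≤ SK := Finset.sum_nonneg fun _ _ => hK _ _
  set A : (S × D × κ × κ → ℝ) →ₗ[ℝ] (S × D × κ × κ → ℝ) := (r * cR39 b) • coordOpK b T with hA
  -- per output coordinate `c`: the slice `(ν, ·, c)` carries `λ`, the block decomposition of the slice is summed through the majorant
  have hcoord : ∀ c : κ, cR39 b * |b.repr (r • T ν lam x) c| ≤ coordBound39 b * (cl * SK) := by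
    intro c
    set μ : S × D × κ × κ → ℝ := sliceK b ν c lam with hμ
    have hAμ : A μ (x, ν, c, c) = r * cR39 b * b.repr (T ν lam x) c := by
      rw [hA, LinearMap.smul_apply, Pi.smul_apply, smul_eq_mul, hμ, coordOpK_sliceK]
    have hdec : A μ (x, ν, c, c) = ∑ y : g.Site, A (blockPiece (fun p : S × D × κ × κ => sI p.1) y μ) (x, ν, c, c) := by
      conv_lhs => rw [← sum_blockPiece (g := g) (fun p : S × D × κ × κ => sI p.1) μ]
      rw [map_sum, Finset.sum_apply]
    -- the bound of the slice on every block: `coordBound · cl`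
    have hB : ∀ q : S × D × κ × κ, |μ q| ≤ coordBound39 b * cl := fun q =>
      (abs_sliceK_le b ν c lam q).trans (mul_le_mul_of_nonneg_left (hbd q.1) (norm_nonneg _))
    have hterm : ∀ y : g.Site, |A (blockPiece (fun p : S × D × κ × κ => sI p.1) y μ) (x, ν, c, c)| ≤
        if y ∈ I then K (sI x) y * (coordBound39 b * cl) else 0 := by
      intro y
      split_ifs with hy
      · have hsupp' : BlockSupp (g := g) (fun p : S × D × κ × κ => sI p.1) (blockPiece (fun p : S × D × κ × κ => sI p.1) y μ) y
            (coordBound39 b * cl) :=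
          blockSupp_blockPiece (g := g) _ μ y _ (mul_nonneg (norm_nonneg _) hc) fun q _ => hB q
        exact hT y _ _ hsupp' (x, ν, c, c)
      · -- off the blocks met by the support the piece vanishes identically
        have hzero : blockPiece (g := g) (fun p : S × D × κ × κ => sI p.1) y μ = 0 := by
          funext q
          simp only [blockPiece, Pi.zero_apply]
          split_ifs with hq
          · by_contra hne
            apply hy
            have hPq : P q.1 := by
              by_contra hP
              exact hne (sliceK_eq_zero_of b ν c (hsupp q.1 hP))
            rw [← hq]
            exact hI q.1 hPq
          · rfl
        rw [hzero, map_zero, Pi.zero_apply, abs_zero]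
    have hsum : |A μ (x, ν, c, c)| ≤ SK * (coordBound39 b * cl) := by
      rw [hdec]
      refine (Finset.abs_sum_le_sum_abs _ _).trans ?_
      refine (Finset.sum_le_sum fun y _ => hterm y).trans ?_
      rw [Finset.sum_ite_mem, Finset.univ_inter, hSK, Finset.sum_mul]
    rw [hAμ] at hsum
    rw [map_smul, Finsupp.smul_apply, smul_eq_mul, abs_mul, abs_of_nonneg hr]
    calc cR39 b * (r * |b.repr (T ν lam x) c|) = |r * cR39 b * b.repr (T ν lam x) c| := by
          rw [abs_mul, abs_mul, abs_of_nonneg hr, abs_of_nonneg (cR39_nonneg b)]; ring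
      _ ≤ SK * (coordBound39 b * cl) := hsum
      _ = coordBound39 b * (cl * SK) := by ring
  have hn : ‖r • T ν lam x‖ ≤ cl * SK := norm_le_of_cR39_repr_le b _ (mul_nonneg hc hSK0) hcoord
  rwa [norm_smul, Real.norm_of_nonneg hr] at hn

end Slice

/-! ## §2 A LEVEL-∕1-FAITHFUL block map on sites: the lengths, the distances, the count and the block sums it produces -/

section Geometry

open Node00 (SiteY BlkY IBondY FBondY toKT etaS)
open B6Geom246MultiLevelBox (blkOf)
open B6GlobalChartV1 (blkV1 boxEquiv)
open B6Ineq2142KLevelV1 (lvl β)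
open B6Ineq288MultiLevelTorus (geoBT_dist dist_symm_geoBT)
open B9CoReadingCoordsS (sIK sIK_level blkV1_site)
open B9Ineq349SiteComposite (lenB distB lenB_eq lenB_pos)
open B9Ineq349SiteFromBlocks (etaS_eq_abs_cf_inv distB_triangle geo9Y_dist_eq_distB)
open B9GeoLemma21KLevelV1 (geo9Y_len_pos)
open B9PinMembersKLevelV1 (MemberY geo9Y)
open B9RWSumsReadsNbr (nbr mem_nbr)

variable {d ℓ : ℕ} {hd : 1 ≤ d + 1} {hL : Odd (ℓ + 1) ∧ 1 < ℓ + 1} {b₀ b₁ : ℝ} {Mstar : ℕ}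
variable (x : MemberY d ℓ hd hL b₀ b₁ Mstar) {bI : FBondY x.toKIdx → IBondY x.toKIdx}

/-- **a LEVEL-FAITHFUL block map reads the right length**: `(Lʲη)(sI z) = Lʲ⁽ᶻ⁾η = lenB (Δ(z))`. [cite: Balaban1985BackgroundPropagators, (3.41) p.397 («Lʲη»), bookkeeping] -/
theorem len_sIK_eq_lenB (hlev : ∀ f : FBondY x.toKIdx, lvl x.hN x.D x.hk (bI f) = (blkV1 x.hN x.D f).1.1) (z : SiteY x.toKIdx) :
    (geo9Y x).len (sIK x.toKIdx bI z) = lenB x.toKIdx (blkOf x.D.toDomains z) := by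
  rw [lenB_eq, etaS_eq_abs_cf_inv]
  show (((ℓ + 1 : ℕ) : ℝ)) ^ (lvl x.hN x.D x.hk (sIK x.toKIdx bI z)) * |x.cf|⁻¹ = _
  rw [sIK_level x.toKIdx hlev z]
  push_cast
  rfl

/-- **a 1-FAITHFUL block map sits at most one block away**: `d_T(β(sI z), Δ(z)) ≤ 1`. [cite: Balaban1984PropagatorsII, (2.45)–(2.46) p.231, bookkeeping] -/
theorem distB_sIK_le_one (hβ1 : ∀ f : FBondY x.toKIdx, (B6Geom246MultiLevelTorus.geomT x.D).dist (β x.hN x.D x.hk (bI f)) (blkV1 x.hN x.D f) ≤ 1)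
    (z : SiteY x.toKIdx) : distB x.toKIdx (β x.hN x.D x.hk (sIK x.toKIdx bI z)) (blkOf x.D.toDomains z) ≤ 1 := by
  have h := hβ1 ⟨(boxEquiv x.hN).symm z, 0⟩
  rw [blkV1_site] at h
  exact h

/-- `d_T` of the blocks is symmetric. [cite: Balaban1984PropagatorsII, (2.46) p.231, bookkeeping] -/
theorem distB_comm (s s' : BlkY x.toKIdx) : distB x.toKIdx s s' = distB x.toKIdx s' s :=
  dist_symm_geoBT (toKT x.toKIdx) s s'

/-- ★ **the block distance is controlled by the index-bond distance of a 1-faithful map**: `d_T(Δ(z), Δ(z₁)) ≤ d(sI z, sI z₁) + 2` ((2.54) twice).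
[cite: Balaban1984PropagatorsII, (2.46) p.231 + (2.54) p.233] -/
theorem distB_le_dist_sIK_add_two
    (hβ1 : ∀ f : FBondY x.toKIdx, (B6Geom246MultiLevelTorus.geomT x.D).dist (β x.hN x.D x.hk (bI f)) (blkV1 x.hN x.D f) ≤ 1)
    (z z₁ : SiteY x.toKIdx) :
    distB x.toKIdx (blkOf x.D.toDomains z) (blkOf x.D.toDomains z₁) ≤ (geo9Y x).dist (sIK x.toKIdx bI z) (sIK x.toKIdx bI z₁) + 2 := by
  rw [geo9Y_dist_eq_distB]
  have h1 := distB_sIK_le_one x hβ1 z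
  have h2 := distB_sIK_le_one x hβ1 z₁
  rw [distB_comm] at h1
  have t1 := distB_triangle x.toKIdx (blkOf x.D.toDomains z) (β x.hN x.D x.hk (sIK x.toKIdx bI z)) (blkOf x.D.toDomains z₁)
  have t2 := distB_triangle x.toKIdx (β x.hN x.D x.hk (sIK x.toKIdx bI z)) (β x.hN x.D x.hk (sIK x.toKIdx bI z₁)) (blkOf x.D.toDomains z₁)
  linarith

/-- the exponential form: `e^{−δ d(sI z, sI z₁)} ≤ e^{2δ}·e^{−δ d_T(Δ(z), Δ(z₁))}` for `δ ≥ 0`. [cite: Balaban1984PropagatorsII, (2.54) p.233, bookkeeping] -/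
theorem exp_dist_sIK_le (hβ1 : ∀ f : FBondY x.toKIdx, (B6Geom246MultiLevelTorus.geomT x.D).dist (β x.hN x.D x.hk (bI f)) (blkV1 x.hN x.D f) ≤ 1)
    {δ : ℝ} (hδ : 0 ≤ δ) (z z₁ : SiteY x.toKIdx) :
    Real.exp (-(δ * (geo9Y x).dist (sIK x.toKIdx bI z) (sIK x.toKIdx bI z₁))) ≤
      Real.exp (2 * δ) * Real.exp (-(δ * distB x.toKIdx (blkOf x.D.toDomains z) (blkOf x.D.toDomains z₁))) := by
  rw [← Real.exp_add]
  apply Real.exp_le_exp.2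
  have h := mul_le_mul_of_nonneg_left (distB_le_dist_sIK_add_two x hβ1 z z₁) hδ
  linarith

open Classical in
/-- ★ **THE BLOCKS MET BY THE SUPPORT ARE FEW**: the index bonds `sI(B(y₁))` lie pairwise within distance `2`, hence inside one radius-2 neighbourhood —
at most `mN` of them under the knit's count `#nbr(·, 2) ≤ mN`. [cite: Balaban1985BackgroundPropagators, p.397 (Δ̃(y)); Balaban1984PropagatorsII, (2.46) p.231, bookkeeping] -/
theorem card_image_sIK_le [Fintype (geo9Y x).Site]
    (hβ1 : ∀ f : FBondY x.toKIdx, (B6Geom246MultiLevelTorus.geomT x.D).dist (β x.hN x.D x.hk (bI f)) (blkV1 x.hN x.D f) ≤ 1)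
    {mN : ℕ} (hnbr : ∀ y : (geo9Y x).Site, (nbr (geo9Y x) 2 y).card ≤ mN) (s₁ : BlkY x.toKIdx) :
    ((Finset.univ.filter fun z : SiteY x.toKIdx => blkOf x.D.toDomains z = s₁).image (sIK x.toKIdx bI)).card ≤ mN := by
  set I := (Finset.univ.filter fun z : SiteY x.toKIdx => blkOf x.D.toDomains z = s₁).image (sIK x.toKIdx bI) with hI
  rcases I.eq_empty_or_nonempty with hE | ⟨bs, hbs⟩
  · rw [hE, Finset.card_empty]; exact Nat.zero_le _
  · have hmem : ∀ b ∈ I, ∃ z : SiteY x.toKIdx, blkOf x.D.toDomains z = s₁ ∧ sIK x.toKIdx bI z = b := by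
      intro b hb
      rw [hI, Finset.mem_image] at hb
      obtain ⟨z, hz, hzb⟩ := hb
      exact ⟨z, (Finset.mem_filter.1 hz).2, hzb⟩
    obtain ⟨zs, hzs, hzsb⟩ := hmem bs hbs
    have hsub : I ⊆ nbr (geo9Y x) 2 bs := by
      intro b hb
      obtain ⟨z₁, hz₁, hz₁b⟩ := hmem b hb
      refine mem_nbr.2 ?_
      rw [← hz₁b, ← hzsb, geo9Y_dist_eq_distB]
      have h1 := distB_sIK_le_one x hβ1 z₁
      have h2 := distB_sIK_le_one x hβ1 zs
      rw [hz₁] at h1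
      rw [hzs, distB_comm] at h2
      have t := distB_triangle x.toKIdx (β x.hN x.D x.hk (sIK x.toKIdx bI z₁)) s₁ (β x.hN x.D x.hk (sIK x.toKIdx bI zs))
      linarith
    exact (Finset.card_le_card hsub).trans (hnbr bs)

open Classical in
/-- ★★ **THE BLOCK SUM OF AN EXPONENTIAL MAJORANT OVER THE BLOCKS MET BY `B(y₁)`**: for `x ∈ B(y)`, a prefactor `w(Lʲη)` and `C, δ ≥ 0`,
`Σ_{b₁ ∈ sI(B(y₁))} C·w((Lʲη)(sI x))·e^{−δ d(sI x, b₁)} ≤ mN · C·w(lenB y)·e^{2δ}·e^{−δ d_T(y, y₁)}` (level-faithful: the length IS `lenB y`;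
1-faithful: the distance; the count). [cite: Balaban1985BackgroundPropagators, Thm 3.1 (3.42) p.397; Balaban1984PropagatorsII, (2.51) p.232, (2.54) p.233] -/
theorem sum_image_sIK_le [Fintype (geo9Y x).Site]
    (hlev : ∀ f : FBondY x.toKIdx, lvl x.hN x.D x.hk (bI f) = (blkV1 x.hN x.D f).1.1)
    (hβ1 : ∀ f : FBondY x.toKIdx, (B6Geom246MultiLevelTorus.geomT x.D).dist (β x.hN x.D x.hk (bI f)) (blkV1 x.hN x.D f) ≤ 1)
    {mN : ℕ} (hnbr : ∀ y : (geo9Y x).Site, (nbr (geo9Y x) 2 y).card ≤ mN) {C δ : ℝ} (hC : 0 ≤ C) (hδ : 0 ≤ δ) (w : ℝ → ℝ)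
    {s s₁ : BlkY x.toKIdx} (hw : 0 ≤ w (lenB x.toKIdx s)) {z : SiteY x.toKIdx} (hz : blkOf x.D.toDomains z = s) :
    ∑ b ∈ (Finset.univ.filter fun z : SiteY x.toKIdx => blkOf x.D.toDomains z = s₁).image (sIK x.toKIdx bI),
        C * w ((geo9Y x).len (sIK x.toKIdx bI z)) * Real.exp (-(δ * (geo9Y x).dist (sIK x.toKIdx bI z) b)) ≤
      mN * (C * w (lenB x.toKIdx s) * Real.exp (2 * δ) * Real.exp (-(δ * distB x.toKIdx s s₁))) := by
  set I := (Finset.univ.filter fun z : SiteY x.toKIdx => blkOf x.D.toDomains z = s₁).image (sIK x.toKIdx bI) with hI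
  set t : ℝ := C * w (lenB x.toKIdx s) * Real.exp (2 * δ) * Real.exp (-(δ * distB x.toKIdx s s₁)) with ht
  have ht0 : 0 ≤ t := by rw [ht]; positivity
  have hterm : ∀ b ∈ I, C * w ((geo9Y x).len (sIK x.toKIdx bI z)) * Real.exp (-(δ * (geo9Y x).dist (sIK x.toKIdx bI z) b)) ≤ t := by
    intro b hb
    rw [hI, Finset.mem_image] at hb
    obtain ⟨z₁, hz₁, rfl⟩ := hb
    have hz₁' : blkOf x.D.toDomains z₁ = s₁ := (Finset.mem_filter.1 hz₁).2
    rw [len_sIK_eq_lenB x hlev z, hz, ht]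
    have he := exp_dist_sIK_le x hβ1 hδ z z₁
    rw [hz, hz₁'] at he
    have hCw : 0 ≤ C * w (lenB x.toKIdx s) := mul_nonneg hC hw
    calc C * w (lenB x.toKIdx s) * Real.exp (-(δ * (geo9Y x).dist (sIK x.toKIdx bI z) (sIK x.toKIdx bI z₁)))
        ≤ C * w (lenB x.toKIdx s) * (Real.exp (2 * δ) * Real.exp (-(δ * distB x.toKIdx s s₁))) := mul_le_mul_of_nonneg_left he hCw
      _ = _ := by ring
  have hcard := card_image_sIK_le x hβ1 hnbr s₁
  calc ∑ b ∈ I, C * w ((geo9Y x).len (sIK x.toKIdx bI z)) * Real.exp (-(δ * (geo9Y x).dist (sIK x.toKIdx bI z) b))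
      ≤ I.card • t := Finset.sum_le_card_nsmul _ _ _ hterm
    _ = (I.card : ℝ) * t := by rw [nsmul_eq_mul]
    _ ≤ mN * t := mul_le_mul_of_nonneg_right (by exact_mod_cast hcard) ht0

end Geometry

end Literature.MathematicalPhysics.QuantumFieldTheory.Balaban1983to89.B9CoordSliceMajorant

end
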